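import Summits.BirchSwinnertonDyer.BirchSwinnertonDyer.Theses.MordellShaFreeCut
import Summits.BirchSwinnertonDyer.BirchSwinnertonDyer.Theorems.MordellShaFreeCutExistenceFromTwoFacts

set_option linter.dupNamespace false

/-! # BC3 skeleton — crux `RankPosOfThreeSelmerCorankOne` (route `MordellShaFreeCut`, rung S2b;
stmt-BirchSwinnertonDyer-19159, the route's declared RESIDUAL crux A), line `heegner-field-bdp-triple` (v6b)

**Version v6br′ (= v6br with the Tate–Sen conjunct DROPPED: RI7)** (prepared by prover seat `bsd-cn100-s2b-c3` g8 for the plan seat, 2026-08-27, per plan g16 RULING-3 (2)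
«re-cut v6bq → v6br of 19159 AUTHORISED IN PRINCIPLE … (b) READY skeleton»; the plan seat registers) = the REGISTERED v6bq
(950e43eff8a2bf9d) with ONE change: the ∃∧ stub `stub_threeAdicBDPElementExistsWithValue` (EV∃ = existence ∧ value at 𝟙) is
REPLACED by its VALUE half alone, `stub_threeAdicBDPValueAtOne : ThreeAdicBDPValueAtOne` (the EXISTING ∀-frame def of
p439508 — no new def, no odd-`d_K` restriction in the stub; the weakest-sufficient restrictions live in the plumbing), because
the EXISTENCE half is now CITATION-BORNE at the road's own Heegner fields: the crux-A plumbing chooses its Heegner field by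
Hoffstein–Luo with `d_K ≡ 1 (mod 8)` (`exists_heegnerField_descent_of_selmerCorank_eq_one`, from the RI facts AS TYPED), and at
odd `d_K` (LB-exist) ⟸ (T1) Hsieh 2014 Thm A at any level + the Tate–Sen theorem + BDP13 Thm 5.5
(`MordellShaFreeCutThreeAdicExistenceFromPrint.threeAdicBDPElementExistsOddDisc_of_anyLevel_of_tateSen_of_bdp2013`, p489731,
over the pointwise descent engine p489385 = x11b3's K4″/sharp engine re-run at `j = 0`). Accordingly `stub_refereedInputs` GROWS
from five to SEVEN citation-borne conjuncts: the v6bq five ∧ (T1) `Hsieh2014.thmA_exists_isHsiehLFunction_unrPeriod_anyLevel`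
[p479919; (E1″) TWO-READ] ∧ `bertoliniDarmonPrasanna2013_centralValue_reciprocity` [reviewed, p419864] — NO Tate–Sen: the
Tate–Sen-free engine `MordellShaFreeCutThreeAdicHsiehDescentUnrPeriod` (p491859; x11b3 desc3-p1 g3's finite-orbit argument, valid
because (T1) types the period in `R₀ˣ`) replaces p489385 in the existence theorem
(`MordellShaFreeCutExistenceFromTwoFacts.threeAdicBDPElementExistsOddDisc_of_anyLevel_of_bdp2013`). `stub_threeLocNonDegeneracy` and
`stub_threeAdicWanDivisibility` are TOKEN-IDENTICAL with v6bq. FOUR stubs, every one load-bearing; sorries 4.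
COMPOSITION (kernel-checked, no sorry outside the stubs): `RankPosOfThreeSelmerCorankOne_of_stubs :=
MordellShaFreeCutExistenceFromTwoFacts.cruxA_of_res_of_anyLevel_of_bdp2013_of_value_of_wan` (census binders verbatim:
hpar hmod hHL hKato hHP · hres · hT1 hBDP · hV · hWan). EFFECT when registered: 19159's ACTIVE research
stubs are {(res), (LB-bdp) value formula at 𝟙, (LB-wan)}; EV∃ `ThreeAdicBDPElementExistsWithValue` leaves the registry but stays a
tree def with live consumers (p478070, p488624); the S2b existence question at EVEN `d_K` is off every served line (recorded, not
claimed solved). The historical header of v6bq/v6bp/v6b/v6 is kept by reference (plan copy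
HOME/bsd-cn100-plan/routes-g15/bc/RankPosOfThreeSelmerCorankOne_heegnerFieldBDPTriple_v6bq.lean).

THE LINE (all symbols tree objects; stated on a globally minimal `W/ℚ` with `j = 0` inside the census
theorem, crux A on `mordellCurve D` by the tree's minimal-model reduction):
(1) `stub_refereedInputs` [S, CITATION-BORNE]: `3`-parity, modularity, Hoffstein–Luo 1997, Kato 2004, Gross 1984, AND the
    two printed named facts (T1) Hsieh 2014 Thm A (any level), BDP13 Thm 5.5.
(2) `stub_threeLocNonDegeneracy` [XL, OPEN — (res) at the additive prime `3`]: token-identical with v4–v6bq.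
(3) `stub_threeAdicBDPValueAtOne` [XL — (LB-bdp) the ∀-frame VALUE FORMULA at 𝟙 at the additive prime `3`:
    `𝓛(𝟙) = u·c⁻²·(1 − a₃3⁻¹ + [3 ∤ N]3⁻¹)²·(log_ω P)²`, `u ∈ R₀ˣ`; OPEN in print at `3 ∣ N`, WRITTEN (MEMO-transfer-13 Thm 13.2
    twin); its ∀-frame quantifier costs ONE frame per datum by value rigidity p479337 / R∞ p489662].
(4) `stub_threeAdicWanDivisibility` [XL, OPEN — (LB-wan)]: token-identical with v6bq / crux B's v5b.
NET: crux A = (res) at `3` + {(LB-bdp) value at 𝟙, (LB-wan)} + seven citation-borne facts; Poitou–Tate, Link A, the descent and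
the existence of the BDP frame PROVED / citation-borne. HONESTY: nothing about BSD, the leaf `rankOne_threeConverse_mordellCurve`,
crux A or Sylvester's problem is proved here; CONDITIONAL plumbing over OPEN statements and named facts. PARTITION: none (RANK axis). -/

noncomputable section

open scoped Classical

namespace Summit.BirchSwinnertonDyer.BirchSwinnertonDyer.Cruxes.RankPosOfThreeSelmerCorankOne.HeegnerFieldBDPTriple

open PowerSeries WeierstrassCurve NumberField IsDedekindDomain Field Literature.NumberTheory.EllipticCurves
  Literature.NumberTheory.EllipticCurves.ModularForms Literature.NumberTheory.QuadraticFields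
  Literature.NumberTheory.EllipticCurves.Castella2018
open Summit.BirchSwinnertonDyer.BirchSwinnertonDyer.Theses.MordellShaFreeCut
open Literature.NumberTheory.GaloisRepresentations Literature.NumberTheory.GaloisCohomology
open Summit.BirchSwinnertonDyer.BirchSwinnertonDyer.Theorems.MordellShaFreeCutThreeAdicBDPTriple
  (ThreeAdicWanDivisibility ThreeAdicBDPValueAtOne)
open Summit.BirchSwinnertonDyer.BirchSwinnertonDyer.Theorems.MordellShaFreeCutExistenceFromTwoFacts
  (cruxA_of_res_of_anyLevel_of_bdp2013_of_value_of_wan)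

/-- **stub_refereedInputs** (size S, CITATION-BORNE; not a research target): the five refereed inputs of v6bq
(`p`-parity, modularity, Hoffstein–Luo, Kato, existence of Heegner points) AND the three PRINTED named facts that carry the
existence half of the BDP frame at odd `d_K` — (T1) Hsieh 2014 Thm A at any level, BDP13 Thm 5.5 — verbatim as the hypothesis
types of `cruxA_of_res_of_anyLevel_of_bdp2013_of_value_of_wan`.
[cite: DokchitserDokchitserAnnals2010, Thm. 1.4] [cite: Kato2004, Cor. 14.3] [cite: Gross1984, §§3–4]
[cite: Hsieh2014, Thm. A p. 712 = Thm. 1 (arXiv:1112.1580 pp. 3–4)] [cite: BertoliniDarmonPrasanna2013, Thm. 5.5 and (5.1.16) (p. 60)] -/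
theorem stub_refereedInputs :
    (∀ (W : WeierstrassCurve ℚ) [W.IsElliptic] (p : ℕ) [Fact p.Prime], p_parity W p) ∧
    ModularForms.exists_isNewformOf ∧
    HoffsteinLuo1997_exists_twist_L_one_ne_zero ∧
    (∀ (W : WeierstrassCurve ℚ) [W.IsElliptic] (p : ℕ) [Fact p.Prime],
      kato_finite_of_L_one_ne_zero W p) ∧
    (∀ (W : WeierstrassCurve ℚ) (K : Type) [Field K] [NumberField K], exists_isHeegnerPoint W K) ∧
    Hsieh2014.thmA_exists_isHsiehLFunction_unrPeriod_anyLevel ∧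
    bertoliniDarmonPrasanna2013_centralValue_reciprocity := by
  sorry

/-- **stub_threeLocNonDegeneracy** (size XL, OPEN — (res) at the additive prime `3`, THE research kernel
of the Ш-freeness half in SELMER currency; token-identical with v4/v5/v6/v6b/v6bp/v6bq). For `W/ℚ` elliptic, globally
minimal with `j = 0`, an imaginary quadratic `K` with `3` split, and `corank_{ℤ₃} Sel_{3^∞}(W/K) = 1`:
at every place `w ∣ 3` of `K` the `w`-strict Selmer group is FINITE. Necessary for crux A (p435058,
fact-free); OPEN at additive `3`. [cite: Skinner2020, Thm. B and §2.2 (shape of the hypothesis)]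
[cite: WZhang2014, Thm. 1.3 and Remark 2 (p. 198)] -/
theorem stub_threeLocNonDegeneracy :
    ∀ (W : WeierstrassCurve ℚ) [W.IsElliptic] [W.IsGloballyMinimal], W.j = 0 →
      ∀ (K : Type) [Field K] [NumberField K],
      IsImaginaryQuadratic K → SatisfiesHeegnerHypothesis 3 K →
        (W.baseChange K).selmerCorank 3 = 1 →
      ∀ (w : HeightOneSpectrum (𝓞 K)), ((3 : ℕ) : 𝓞 K) ∈ w.asIdeal →
        Finite ↥((W.baseChange K).selmerGroupPInfty 3 ⊓
          selmerLocalKerPrimaryTorsion (W.baseChange K) (w.adicCompletion K) 3) := by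
  sorry

/-- **stub_threeAdicBDPValueAtOne** (size XL — (LB-bdp), the ∀-frame VALUE FORMULA AT THE TRIVIAL CHARACTER at the additive
prime `3`): for every admissible exact frame `(ι′, Ω_K, Ω_p, 𝓛)` of the newform of a globally minimal `j = 0` curve over a
Heegner field with `3 = v v̄`, `𝓛(𝟙) = u·c⁻²·(1 − a₃3⁻¹ + [3 ∤ N]3⁻¹)²·(log_ω P)²` with `u ∈ R₀ˣ` — the LANDED `@[conjecture] def`
of p439508 (`MordellShaFreeCutThreeAdicBDPTriple.ThreeAdicBDPValueAtOne`). OPEN in print at `3 ∣ N` (BDP13 Thm 5.13 /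
Castella–Hsieh 2018 need `p ∤ N`, Castella 2018 Thm 3.2 needs `p ∥ N`); WRITTEN (MEMO-transfer-13 Thm 13.2 twin); the ∀-frame
quantifier costs ONE frame with its value per datum (`threeAdicBDPValueAtOne_of_frameValue` p479337, R∞ p489662). The EXISTENCE
of the frame it quantifies over is citation-borne at odd `d_K` ({(T1), BDP13}) — the reason this stub replaces v6bq's ∃∧ stub.
[cite: Castella2018, Thm. 3.2 (arXiv:1704.06608 p. 9) (shape; nothing asserted at 3 ∣ N)]
[cite: BertoliniDarmonPrasanna2013, Thm. 5.13 (shape)] -/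
theorem stub_threeAdicBDPValueAtOne : ThreeAdicBDPValueAtOne := by
  sorry

/-- **stub_threeAdicWanDivisibility** (size XL, OPEN — THE analytic research statement shared with crux
B): (LB-wan); token-identical with v6bq and crux B's v5b; honest cost ONE admissible frame per datum (Cor 13.4 =
`threeAdicWanDivisibility_of_frameDivisibility`, p489662). [cite: CastellaGrossiLeeSkinner2022, Thm. 4.2.2 (shape of the other divisibility)] -/
theorem stub_threeAdicWanDivisibility : ThreeAdicWanDivisibility := by
  sorry

/-- The skeleton composition (v6br′): crux A exactly as the LANDED census theorem
`MordellShaFreeCutExistenceFromTwoFacts.cruxA_of_res_of_anyLevel_of_bdp2013_of_value_of_wan` (bsd-cn100-s2b-c3 g8) — pass to a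
globally minimal model `C • E_D`, descend to a Heegner field with `d_K ≡ 1 (mod 8)` (Hoffstein–Luo), Link A in corank form from
(res) (`threeAdicControlOfCorankOne_of_locNonDegeneracy`, p457636), existence of the frame from the two named facts (Tate–Sen-free
engine p491859), the ∀-frame value at 𝟙, (LB-wan), Mordell–Weil — the ONLY theorem of this file concluding the crux by name. [cite: SilvermanAEC2009, III.3.1(b) and VIII.8] [cite: CastellaGrossiLeeSkinner2022, §5.2 (proof of Thm. 5.2.1)] -/
theorem RankPosOfThreeSelmerCorankOne_of_stubs : RankPosOfThreeSelmerCorankOne :=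
  cruxA_of_res_of_anyLevel_of_bdp2013_of_value_of_wan
    stub_refereedInputs.1 stub_refereedInputs.2.1 stub_refereedInputs.2.2.1 stub_refereedInputs.2.2.2.1
    stub_refereedInputs.2.2.2.2.1
    stub_threeLocNonDegeneracy
    stub_refereedInputs.2.2.2.2.2.1 stub_refereedInputs.2.2.2.2.2.2
    stub_threeAdicBDPValueAtOne stub_threeAdicWanDivisibility

end Summit.BirchSwinnertonDyer.BirchSwinnertonDyer.Cruxes.RankPosOfThreeSelmerCorankOne.HeegnerFieldBDPTriple

end
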